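import Literature.NumberTheory.EllipticCurves.WeilPairingShapiroLevelTransport
import Literature.NumberTheory.EllipticCurves.Kato2004.IwasawaH1ReductionPkTransition
import HarnessLib

/-!
# Level transport of the Shapiro cup classes of a Weil family over the `p`-power tower:
# `Sh(a_L) ∪_{Σ e_L} Sh[ψ_L] = (ι_μ)_* ( Sh(a_{L₀}) ∪_{Σ e_{L₀}} Sh[ψ_{L₀}] )`, `L ≥ L₀`

Topic `NumberTheory/EllipticCurves` (`Kato2004/` for the `T_pW`-specialisation); theorems only (no definition,
no named fact, no instance, no `sorry`).  This file assembles, in the `p`-power tower `μ_{p^{L₀}} ⊆ μ_{p^L}`,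
`E[p^{L₀}] ⊆ E[p^L]`, `[p^{L−L₀}] : E[p^L] → E[p^{L₀}]`, the hypothesis **`htrans`** of the Poitou–Tate assembly
of crux K3 of `Summits/BirchSwinnertonDyer` (`Theorems/…LayerPoitouTateShapiro.lean`,
`two_nsmul_localInvariantMap_cup_shapiroLift_eq_zero`) VERBATIM, for the first factors `A_L := Maps(Γ ⧸ U, E[p^L])`,
`a_L := Sh_U(aa_L)`, pairings `P_L :=` the summed pairing of `weilContPairing W (p^L) (e L) …`, from

* a family of `Γ_F`-equivariant biadditive pairings `e L : E[p^L] × E[p^L] → μ_{p^L}` COMPATIBLE along the tower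
  (`hcompat`, Silverman III.8.1 (e), quantified over all level maps given on points — discharged for the tree's
  Weil pairing functions by `weilPairingFun_hcompat_pow`);
* layer cocycles `ψ_L : U → E[p^L]` with the SAME values in `E(F̄)` (`hψ`; e.g. the finite-level lifts of one
  layer Selmer cocycle);
* layer classes `aa_L ∈ H¹(U, E[p^L])` compatible under `[p^{L−L₀}]_*` (`haa`; discharged for
  `aa_L := (r_L)_* red_{p^L} x`, `x ∈ H¹(U, T_pW)`, by the tree's `cohomologyMap_mapH1AddHom_reduceH1Pk_add` —
  `shapiroCup_weil_htrans_reduceH1Pk`, over `ℚ`).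

## Main statements
* `cohomologyMap_subgroupRepMap_oneCocycleClass_of_coe_eq` — cocycles with the same values in `E(F̄)` have
  `β_* [ψ₁] = [ψ₂]` for every level map `β` which is the identity on points;
* `weilPairingFun_torsion_pow/_add_left/_add_right/_smul` — the tree's `weilPairingFun` restricted to `E[n]`
  satisfies the four hypotheses of `weilContPairing`; `weilPairingFun_hcompat_pow` — and the tower compatibility;
* **`shapiroCup_weil_htrans`** — the level transport `c_L = (ι_μ)_* c_{L₀}` (general field `F`, any open
  finite-index `U ≤ Γ_F`, abstract compatible family `e`);
* **`shapiroCup_weil_htrans_reduceH1Pk`** — the same over `ℚ` with `aa_L := (r_L)_* red_{p^L} x` for ANY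
  re-typings `r_L : E[(p:ℤ)^L] → E[((p^L : ℕ) : ℤ)]` which are the identity on points (`haa` discharged).

## References
* [SilvermanAEC2009] J. H. Silverman, *The Arithmetic of Elliptic Curves*, 2nd ed. (2009), Prop. III.8.1.
* [NeukirchSchmidtWingberg2008] Neukirch–Schmidt–Wingberg, *Cohomology of Number Fields* (2008), I §4 (1.4.2), I §6 (1.6.4).
* [Kato2004Asterisque] K. Kato, Astérisque 295 (2004), §13.8 (p. 228), §17.13 (p. 279).
* [Kobayashi2003] S. Kobayashi, Invent. math. 152 (2003), (7.16)–(7.21) (p. 12).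
-/

noncomputable section

open scoped NumberField Classical
open Field IsDedekindDomain CategoryTheory
open Literature.NumberTheory.GaloisRepresentations
open Literature.NumberTheory.GaloisRepresentations.DiscreteGaloisModule (mu MuCarrier)
open WeierstrassCurve (geomPoints geomTorsion weilPairingFun)
open _root_.TopRep _root_.ContinuousCohomology
open scoped ContRepresentation

universe u

namespace Literature.NumberTheory.EllipticCurves

/-! ## §1 Cocycles with the same values -/

section SameValues

variable {F : Type u} [Field F] (W : WeierstrassCurve F) {m₁ m₂ : ℤ} (U : Subgroup (absoluteGaloisGroup F))

/-- **`β_* [ψ₁] = [ψ₂]` for cocycles with the same values.**  If `β : E[m₁] → E[m₂]` is a morphism of discrete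
Galois modules and `ψ₁ : U → E[m₁]`, `ψ₂ : U → E[m₂]` are continuous crossed homomorphisms with
`β(ψ₁(x)) = ψ₂(x)` in `E(F̄)` for all `x`, then `β_* [ψ₁] = [ψ₂]` in `H¹(U, E[m₂])` (functoriality of `H¹` on
cocycles, `[φ] ↦ [β ∘ φ]`). [cite: NeukirchSchmidtWingberg2008, I §6 (1.6.4)] -/
theorem cohomologyMap_subgroupRepMap_oneCocycleClass_of_coe_eq
    (β : (W.torsionGaloisModule m₁).toContRepresentation →ⁱL (W.torsionGaloisModule m₂).toContRepresentation)
    (ψ₁ : contOneCocycles (subgroupRep (W.torsionGaloisModule m₁).toTopRep U))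
    (ψ₂ : contOneCocycles (subgroupRep (W.torsionGaloisModule m₂).toTopRep U))
    (h : ∀ x, ((β (ψ₁.1 x) : geomTorsion W m₂) : geomPoints W) = ((ψ₂.1 x : geomTorsion W m₂) : geomPoints W)) :
    cohomologyMap (subgroupRepMap (DiscreteGaloisModule.homOfIntertwining β) U) 1 (oneCocycleClass _ ψ₁) =
      oneCocycleClass _ ψ₂ := by
  rw [cohomologyMap_oneCocycleClass]
  exact congrArg _ (Subtype.ext (ContinuousMap.ext fun x ↦ Subtype.ext (h x)))

end SameValues

/-! ## §2 The tree's Weil pairing functions on `E[n]`: the hypotheses of `weilContPairing`, and the tower compatibility -/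

section WeilFun

variable {F : Type u} [Field F] (W : WeierstrassCurve F) [W.IsElliptic] {n : ℕ} (hn : (n : F) ≠ 0)

/-- `e_n(S, T)^n = 1` on `E[n]`. [cite: SilvermanAEC2009, Prop. III.8.1] -/
theorem weilPairingFun_torsion_pow (S T : geomTorsion W (n : ℤ)) :
    weilPairingFun hn (S : geomPoints W) T ^ n = 1 :=
  WeierstrassCurve.weilPairingFun_pow hn ((W.mem_geomTorsion_iff (n : ℤ) _).1 S.2)
    ((W.mem_geomTorsion_iff (n : ℤ) _).1 T.2)

/-- `e_n` is additive in the first variable on `E[n]`. [cite: SilvermanAEC2009, Prop. III.8.1(a)] -/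
theorem weilPairingFun_torsion_add_left (S₁ S₂ T : geomTorsion W (n : ℤ)) :
    weilPairingFun hn ((S₁ + S₂ : geomTorsion W (n : ℤ)) : geomPoints W) T =
      weilPairingFun hn (S₁ : geomPoints W) T * weilPairingFun hn (S₂ : geomPoints W) T :=
  WeierstrassCurve.weilPairingFun_add_left hn ((W.mem_geomTorsion_iff (n : ℤ) _).1 S₁.2)
    ((W.mem_geomTorsion_iff (n : ℤ) _).1 S₂.2) ((W.mem_geomTorsion_iff (n : ℤ) _).1 T.2)

/-- `e_n` is additive in the second variable on `E[n]`. [cite: SilvermanAEC2009, Prop. III.8.1(a)] -/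
theorem weilPairingFun_torsion_add_right (S T₁ T₂ : geomTorsion W (n : ℤ)) :
    weilPairingFun hn (S : geomPoints W) ((T₁ + T₂ : geomTorsion W (n : ℤ)) : geomPoints W) =
      weilPairingFun hn (S : geomPoints W) T₁ * weilPairingFun hn (S : geomPoints W) T₂ :=
  WeierstrassCurve.weilPairingFun_add_right hn ((W.mem_geomTorsion_iff (n : ℤ) _).1 S.2)
    ((W.mem_geomTorsion_iff (n : ℤ) _).1 T₁.2) ((W.mem_geomTorsion_iff (n : ℤ) _).1 T₂.2)

/-- `e_n` is Galois equivariant on `E[n]`: `σ e_n(S, T) = e_n(σ S, σ T)`. [cite: SilvermanAEC2009, Prop. III.8.1(d)] -/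
theorem weilPairingFun_torsion_smul (σ : absoluteGaloisGroup F) (S T : geomTorsion W (n : ℤ)) :
    σ • weilPairingFun hn (S : geomPoints W) T =
      weilPairingFun hn ((σ • S : geomTorsion W (n : ℤ)) : geomPoints W) ((σ • T : geomTorsion W (n : ℤ)) : geomPoints W) :=
  (WeierstrassCurve.weilPairingFun_smul hn σ ((W.mem_geomTorsion_iff (n : ℤ) _).1 S.2)
    ((W.mem_geomTorsion_iff (n : ℤ) _).1 T.2)).symm

variable {p : ℕ} [hp : Fact p.Prime] (hpow : ∀ L : ℕ, ((p ^ L : ℕ) : F) ≠ 0)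

omit hn in
include hpow in
/-- **Tower compatibility of the Weil pairing functions (Silverman III.8.1 (e)) in the `p`-power tower, for all
level maps given on points**: for `L₀ ≤ L`, `α : E[p^L] → E[p^{L₀}]` acting as `S ↦ p^{L−L₀} S` and
`β : E[p^{L₀}] → E[p^L]` acting as `T ↦ T`, `e_{p^L}(S', β T) = e_{p^{L₀}}(α S', T)` — the hypothesis `hcompat` of
`shapiroCup_weil_htrans` for `e L := weilPairingFun (hpow L)`. [cite: SilvermanAEC2009, Prop. III.8.1(e)] -/
theorem weilPairingFun_hcompat_pow (L₀ L : ℕ) (hL : L₀ ≤ L)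
    (α : (W.torsionGaloisModule ((p ^ L : ℕ) : ℤ)).toContRepresentation →ⁱL
      (W.torsionGaloisModule ((p ^ L₀ : ℕ) : ℤ)).toContRepresentation)
    (β : (W.torsionGaloisModule ((p ^ L₀ : ℕ) : ℤ)).toContRepresentation →ⁱL
      (W.torsionGaloisModule ((p ^ L : ℕ) : ℤ)).toContRepresentation)
    (hα : ∀ S, ((α S : geomTorsion W ((p ^ L₀ : ℕ) : ℤ)) : geomPoints W) = (p : ℤ) ^ (L - L₀) • (S : geomPoints W))
    (hβ : ∀ T, ((β T : geomTorsion W ((p ^ L : ℕ) : ℤ)) : geomPoints W) = (T : geomPoints W))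
    (S' : geomTorsion W ((p ^ L : ℕ) : ℤ)) (T : geomTorsion W ((p ^ L₀ : ℕ) : ℤ)) :
    weilPairingFun (hpow L) (S' : geomPoints W) ((β T : geomTorsion W ((p ^ L : ℕ) : ℤ)) : geomPoints W) =
      weilPairingFun (hpow L₀) ((α S' : geomTorsion W ((p ^ L₀ : ℕ) : ℤ)) : geomPoints W) (T : geomPoints W) := by
  refine weilPairingFun_levelCompat W (pow_dvd_pow p hL) (hpow L₀) (hpow L) α β (fun S ↦ ?_) hβ S' T
  rw [hα S, Nat.pow_div hL hp.out.pos]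
  norm_cast

end WeilFun

/-! ## §3 The level transport `c_L = (ι_μ)_* c_{L₀}` for a compatible family -/

section Family

variable {F : Type u} [Field F] (W : WeierstrassCurve F) {p : ℕ} [hp : Fact p.Prime]
  [CompactSpace (absoluteGaloisGroup F)]
  (U : Subgroup (absoluteGaloisGroup F)) [Fintype (absoluteGaloisGroup F ⧸ U)]
  (hU : IsOpen (U : Set (absoluteGaloisGroup F))) {s : absoluteGaloisGroup F ⧸ U → absoluteGaloisGroup F}
  (hs : ∀ x : absoluteGaloisGroup F ⧸ U, (s x : absoluteGaloisGroup F ⧸ U) = x)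
  (hs1 : s ((1 : absoluteGaloisGroup F) : absoluteGaloisGroup F ⧸ U) = 1) (L₀ : ℕ)
  (e : ∀ L : ℕ, geomTorsion W ((p ^ L : ℕ) : ℤ) → geomTorsion W ((p ^ L : ℕ) : ℤ) → AlgebraicClosure F)
  (hμ : ∀ (L : ℕ) S T, e L S T ^ (p ^ L) = 1)
  (hadd₁ : ∀ (L : ℕ) S₁ S₂ T, e L (S₁ + S₂) T = e L S₁ T * e L S₂ T)
  (hadd₂ : ∀ (L : ℕ) S T₁ T₂, e L S (T₁ + T₂) = e L S T₁ * e L S T₂)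
  (hgal : ∀ (L : ℕ) (σ : absoluteGaloisGroup F) S T, σ • e L S T = e L (σ • S) (σ • T))
  (hcompat : ∀ (L : ℕ) (_ : L₀ ≤ L)
    (α : (W.torsionGaloisModule ((p ^ L : ℕ) : ℤ)).toContRepresentation →ⁱL
      (W.torsionGaloisModule ((p ^ L₀ : ℕ) : ℤ)).toContRepresentation)
    (β : (W.torsionGaloisModule ((p ^ L₀ : ℕ) : ℤ)).toContRepresentation →ⁱL
      (W.torsionGaloisModule ((p ^ L : ℕ) : ℤ)).toContRepresentation),
    (∀ S, ((α S : geomTorsion W ((p ^ L₀ : ℕ) : ℤ)) : geomPoints W) = (p : ℤ) ^ (L - L₀) • (S : geomPoints W)) →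
    (∀ T, ((β T : geomTorsion W ((p ^ L : ℕ) : ℤ)) : geomPoints W) = (T : geomPoints W)) →
    ∀ (S' : geomTorsion W ((p ^ L : ℕ) : ℤ)) (T : geomTorsion W ((p ^ L₀ : ℕ) : ℤ)), e L S' (β T) = e L₀ (α S') T)
  (ψ : ∀ L : ℕ, L₀ ≤ L → contOneCocycles (subgroupRep (W.torsionGaloisModule ((p ^ L : ℕ) : ℤ)).toTopRep U))
  (hψ : ∀ (L : ℕ) (hL : L₀ ≤ L) (x : U),
    (((ψ L hL).1 x : geomTorsion W ((p ^ L : ℕ) : ℤ)) : geomPoints W) =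
      (((ψ L₀ le_rfl).1 x : geomTorsion W ((p ^ L₀ : ℕ) : ℤ)) : geomPoints W))

include hcompat hψ in
/-- **Level transport of the Shapiro cup classes of a compatible Weil family (`htrans`).**  Let `U ≤ Γ_F` be
open of finite index with coset representatives `s`, `e L : E[p^L] × E[p^L] → μ_{p^L}` a family of
`Γ_F`-equivariant biadditive pairings compatible along the tower (`hcompat`), `ψ_L : U → E[p^L]` (`L ≥ L₀`)
continuous crossed homomorphisms with the same values in `E(F̄)` (`hψ`), and `aa_L ∈ H¹(U, E[p^L])` layer classes
with `[p^{L−L₀}]_* aa_L = aa_{L₀}` for every level map `[p^{L−L₀}] : E[p^L] → E[p^{L₀}]` given on points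
(`haa`).  Then for every `L ≥ L₀`, in `H²(Γ_F, μ_{p^L})`:
`Sh_U(aa_L) ∪_{Σ e_L} Sh_U[ψ_L] = (ι_μ)_* ( Sh_U(aa_{L₀}) ∪_{Σ e_{L₀}} Sh_U[ψ_{L₀}] )`, `ι_μ = muInclHom F (p^{L₀} ∣ p^L)`
— the projection formula for the summed cup product on Shapiro lifts (`shapiroLift_cupProduct_weil_levelTransport`)
with `α = [p^{L−L₀}] ∘ (re-typing)`, `β =` the inclusion, and `β_* [ψ_{L₀}] = [ψ_L]`.
[cite: NeukirchSchmidtWingberg2008, I §4 (1.4.2)] [cite: SilvermanAEC2009, Prop. III.8.1(e)]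
[cite: Kobayashi2003, (7.16)–(7.21) (p. 12)] -/
theorem shapiroCup_weil_htrans
    (aa : ∀ L : ℕ, L₀ ≤ L → continuousCohomology 1 (subgroupRep (W.torsionGaloisModule ((p ^ L : ℕ) : ℤ)).toTopRep U))
    (haa : ∀ (L : ℕ) (hL : L₀ ≤ L)
      (α : (W.torsionGaloisModule ((p ^ L : ℕ) : ℤ)).toContRepresentation →ⁱL
        (W.torsionGaloisModule ((p ^ L₀ : ℕ) : ℤ)).toContRepresentation),
      (∀ S, ((α S : geomTorsion W ((p ^ L₀ : ℕ) : ℤ)) : geomPoints W) = (p : ℤ) ^ (L - L₀) • (S : geomPoints W)) →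
      cohomologyMap (subgroupRepMap (DiscreteGaloisModule.homOfIntertwining α) U) 1 (aa L hL) = aa L₀ le_rfl)
    (L : ℕ) (hL : L₀ ≤ L) :
    ((weilContPairing W (p ^ L) (e L) (hμ L) (hadd₁ L) (hadd₂ L) (hgal L)).coindFin U).cupProduct
        (shapiroLift (W.torsionGaloisModule ((p ^ L : ℕ) : ℤ)).toTopRep U hU hs hs1 (aa L hL))
        (shapiroLift (W.torsionGaloisModule ((p ^ L : ℕ) : ℤ)).toTopRep U hU hs hs1 (oneCocycleClass _ (ψ L hL))) =
      cohomologyMap (muInclHom F (pow_dvd_pow p hL)) 2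
        (((weilContPairing W (p ^ L₀) (e L₀) (hμ L₀) (hadd₁ L₀) (hadd₂ L₀) (hgal L₀)).coindFin U).cupProduct
          (shapiroLift (W.torsionGaloisModule ((p ^ L₀ : ℕ) : ℤ)).toTopRep U hU hs hs1 (aa L₀ le_rfl))
          (shapiroLift (W.torsionGaloisModule ((p ^ L₀ : ℕ) : ℤ)).toTopRep U hU hs hs1
            (oneCocycleClass _ (ψ L₀ le_rfl)))) := by
  -- the level maps: `β = ι : E[p^{L₀}] ⊆ E[p^L]`, `α = [p^{L-L₀}] : E[p^L] → E[p^{L₀}]` (through the product level)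
  have hdvdZ : ((p ^ L₀ : ℕ) : ℤ) ∣ ((p ^ L : ℕ) : ℤ) := Int.natCast_dvd_natCast.mpr (pow_dvd_pow p hL)
  have hmulZ : ((p ^ L : ℕ) : ℤ) ∣ (p : ℤ) ^ (L - L₀) * ((p ^ L₀ : ℕ) : ℤ) := by
    refine dvd_of_eq ?_
    push_cast
    rw [← pow_add, Nat.sub_add_cancel hL]
  let β : (W.torsionGaloisModule ((p ^ L₀ : ℕ) : ℤ)).toContRepresentation →ⁱL
      (W.torsionGaloisModule ((p ^ L : ℕ) : ℤ)).toContRepresentation := W.torsionInclusion hdvdZ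
  let α : (W.torsionGaloisModule ((p ^ L : ℕ) : ℤ)).toContRepresentation →ⁱL
      (W.torsionGaloisModule ((p ^ L₀ : ℕ) : ℤ)).toContRepresentation :=
    (W.torsionMulBy ((p : ℤ) ^ (L - L₀)) ((p ^ L₀ : ℕ) : ℤ)).comp (W.torsionInclusion hmulZ)
  have hα : ∀ S, ((α S : geomTorsion W ((p ^ L₀ : ℕ) : ℤ)) : geomPoints W) =
      (p : ℤ) ^ (L - L₀) • (S : geomPoints W) := fun _ ↦ rfl
  have hβ : ∀ T, ((β T : geomTorsion W ((p ^ L : ℕ) : ℤ)) : geomPoints W) = (T : geomPoints W) := fun _ ↦ rfl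
  rw [← haa L hL α hα, shapiroLift_cupProduct_weil_levelTransport W (p ^ L₀) (p ^ L) (pow_dvd_pow p hL)
      (e L₀) (hμ L₀) (hadd₁ L₀) (hadd₂ L₀) (hgal L₀) (e L) (hμ L) (hadd₁ L) (hadd₂ L) (hgal L) α β
      (hcompat L hL α β hα hβ) U hU hs hs1 (aa L hL) (oneCocycleClass _ (ψ L₀ le_rfl)),
    cohomologyMap_subgroupRepMap_oneCocycleClass_of_coe_eq W U β (ψ L₀ le_rfl) (ψ L hL) fun x ↦ by
      rw [hβ]; exact (hψ L hL x).symm]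

end Family

end Literature.NumberTheory.EllipticCurves

/-! ## §4 Over `ℚ`: the first factors `aa_L := (r_L)_* red_{p^L} x`, `x ∈ H¹(U, T_pW)` -/

namespace Literature.NumberTheory.EllipticCurves.Kato2004

open Literature.NumberTheory.EllipticCurves Literature.NumberTheory.EllipticCurves.Kato2004.EulerSystemValues

section Rat

variable (W : WeierstrassCurve ℚ) [W.IsElliptic] {p : ℕ} [hp : Fact p.Prime] [ContinuousSMul ℤ_[p] (W.tateModule p)]
  [CompactSpace (absoluteGaloisGroup ℚ)]
  (U : Subgroup (absoluteGaloisGroup ℚ)) [Fintype (absoluteGaloisGroup ℚ ⧸ U)]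
  (hU : IsOpen (U : Set (absoluteGaloisGroup ℚ))) {s : absoluteGaloisGroup ℚ ⧸ U → absoluteGaloisGroup ℚ}
  (hs : ∀ x : absoluteGaloisGroup ℚ ⧸ U, (s x : absoluteGaloisGroup ℚ ⧸ U) = x)
  (hs1 : s ((1 : absoluteGaloisGroup ℚ) : absoluteGaloisGroup ℚ ⧸ U) = 1) (L₀ : ℕ)
  (e : ∀ L : ℕ, geomTorsion W ((p ^ L : ℕ) : ℤ) → geomTorsion W ((p ^ L : ℕ) : ℤ) → AlgebraicClosure ℚ)
  (hμ : ∀ (L : ℕ) S T, e L S T ^ (p ^ L) = 1)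
  (hadd₁ : ∀ (L : ℕ) S₁ S₂ T, e L (S₁ + S₂) T = e L S₁ T * e L S₂ T)
  (hadd₂ : ∀ (L : ℕ) S T₁ T₂, e L S (T₁ + T₂) = e L S T₁ * e L S T₂)
  (hgal : ∀ (L : ℕ) (σ : absoluteGaloisGroup ℚ) S T, σ • e L S T = e L (σ • S) (σ • T))
  (hcompat : ∀ (L : ℕ) (_ : L₀ ≤ L)
    (α : (W.torsionGaloisModule ((p ^ L : ℕ) : ℤ)).toContRepresentation →ⁱL
      (W.torsionGaloisModule ((p ^ L₀ : ℕ) : ℤ)).toContRepresentation)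
    (β : (W.torsionGaloisModule ((p ^ L₀ : ℕ) : ℤ)).toContRepresentation →ⁱL
      (W.torsionGaloisModule ((p ^ L : ℕ) : ℤ)).toContRepresentation),
    (∀ S, ((α S : geomTorsion W ((p ^ L₀ : ℕ) : ℤ)) : geomPoints W) = (p : ℤ) ^ (L - L₀) • (S : geomPoints W)) →
    (∀ T, ((β T : geomTorsion W ((p ^ L : ℕ) : ℤ)) : geomPoints W) = (T : geomPoints W)) →
    ∀ (S' : geomTorsion W ((p ^ L : ℕ) : ℤ)) (T : geomTorsion W ((p ^ L₀ : ℕ) : ℤ)), e L S' (β T) = e L₀ (α S') T)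
  (ψ : ∀ L : ℕ, L₀ ≤ L → contOneCocycles (subgroupRep (W.torsionGaloisModule ((p ^ L : ℕ) : ℤ)).toTopRep U))
  (hψ : ∀ (L : ℕ) (hL : L₀ ≤ L) (x : U),
    (((ψ L hL).1 x : geomTorsion W ((p ^ L : ℕ) : ℤ)) : geomPoints W) =
      (((ψ L₀ le_rfl).1 x : geomTorsion W ((p ^ L₀ : ℕ) : ℤ)) : geomPoints W))
  (r : ∀ L : ℕ, geomTorsion W ((p : ℤ) ^ L) →+ geomTorsion W ((p ^ L : ℕ) : ℤ))
  (hrc : ∀ L : ℕ, Continuous (r L))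
  (hrρ : ∀ (L : ℕ) (u : U) (P : geomTorsion W ((p : ℤ) ^ L)),
    r L ((subgroupRep (W.torsionGaloisModule ((p : ℤ) ^ L)).toTopRep U).ρ u P) =
      (subgroupRep (W.torsionGaloisModule ((p ^ L : ℕ) : ℤ)).toTopRep U).ρ u (r L P))
  (hr : ∀ (L : ℕ) (P : geomTorsion W ((p : ℤ) ^ L)), ((r L P : geomTorsion W ((p ^ L : ℕ) : ℤ)) : geomPoints W) = P)

include hcompat hψ hr in
/-- **`htrans` for `a_L = Sh((r_L)_* red_{p^L} x)`, `x ∈ H¹(U, T_pW)` (over `ℚ`).**  With the data of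
`shapiroCup_weil_htrans` and, as first factors, the re-typed reductions `aa_L := (r_L)_* red_{p^L} x` of ONE class
`x ∈ H¹(U, T_pW)` (`Kato2004.reduceH1Pk`; `r_L : E[(p:ℤ)^L] → E[((p^L : ℕ) : ℤ)]` any additive continuous equivariant
re-typing which is the identity on points), the hypothesis `haa` holds (`cohomologyMap_mapH1AddHom_reduceH1Pk_add`:
`p^{L−L₀} (a mod p^L) = a mod p^{L₀}`), so for every `L ≥ L₀`:
`Sh((r_L)_* red_{p^L} x) ∪_{Σ e_L} Sh[ψ_L] = (ι_μ)_* ( Sh((r_{L₀})_* red_{p^{L₀}} x) ∪_{Σ e_{L₀}} Sh[ψ_{L₀}] )`.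
[cite: Kato2004Asterisque, §13.8 (p. 228)] [cite: Kobayashi2003, (7.16)–(7.21) (p. 12)] -/
theorem shapiroCup_weil_htrans_reduceH1Pk (x : H1 (tateRep W p) U) (L : ℕ) (hL : L₀ ≤ L) :
    ((weilContPairing W (p ^ L) (e L) (hμ L) (hadd₁ L) (hadd₂ L) (hgal L)).coindFin U).cupProduct
        (shapiroLift (W.torsionGaloisModule ((p ^ L : ℕ) : ℤ)).toTopRep U hU hs hs1
          (mapH1AddHom (subgroupRep (W.torsionGaloisModule ((p : ℤ) ^ L)).toTopRep U)
            (subgroupRep (W.torsionGaloisModule ((p ^ L : ℕ) : ℤ)).toTopRep U) (r L) (hrc L) (hrρ L)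
            (reduceH1Pk W p L U x)))
        (shapiroLift (W.torsionGaloisModule ((p ^ L : ℕ) : ℤ)).toTopRep U hU hs hs1 (oneCocycleClass _ (ψ L hL))) =
      cohomologyMap (muInclHom ℚ (pow_dvd_pow p hL)) 2
        (((weilContPairing W (p ^ L₀) (e L₀) (hμ L₀) (hadd₁ L₀) (hadd₂ L₀) (hgal L₀)).coindFin U).cupProduct
          (shapiroLift (W.torsionGaloisModule ((p ^ L₀ : ℕ) : ℤ)).toTopRep U hU hs hs1
            (mapH1AddHom (subgroupRep (W.torsionGaloisModule ((p : ℤ) ^ L₀)).toTopRep U)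
              (subgroupRep (W.torsionGaloisModule ((p ^ L₀ : ℕ) : ℤ)).toTopRep U) (r L₀) (hrc L₀) (hrρ L₀)
              (reduceH1Pk W p L₀ U x)))
          (shapiroLift (W.torsionGaloisModule ((p ^ L₀ : ℕ) : ℤ)).toTopRep U hU hs hs1
            (oneCocycleClass _ (ψ L₀ le_rfl)))) := by
  refine shapiroCup_weil_htrans W U hU hs hs1 L₀ e hμ hadd₁ hadd₂ hgal hcompat ψ hψ
    (fun L _ ↦ mapH1AddHom (subgroupRep (W.torsionGaloisModule ((p : ℤ) ^ L)).toTopRep U)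
      (subgroupRep (W.torsionGaloisModule ((p ^ L : ℕ) : ℤ)).toTopRep U) (r L) (hrc L) (hrρ L) (reduceH1Pk W p L U x))
    (fun L' hL' α hα ↦ ?_) L hL
  obtain ⟨j, rfl⟩ := Nat.exists_eq_add_of_le hL'
  rw [Nat.add_sub_cancel_left] at hα
  exact cohomologyMap_mapH1AddHom_reduceH1Pk_add W p L₀ U j (r (L₀ + j)) (hrc _) (hrρ _) (hr _) (r L₀) (hrc _)
    (hrρ _) (hr _) α hα x

end Rat

end Literature.NumberTheory.EllipticCurves.Kato2004
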